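import Summits.Ventures.YMGap.Thresholds.PressureZeroCoupling
import Summits.Ventures.YMGap.Thresholds.PlaquetteMonotone
import Summits.Ventures.YMGap.Thresholds.PressureTwoSided
import Summits.Ventures.YMGap.Thresholds.PressureTwoSidedC2
import HarnessLib

/-!
# Venture statement — YMGap (cell `pub-ymgap`) — CONJUNCT BODIES T61 (V22, block 4 of 4)

STATUS: FILED by p2 g12 as contingent filer under lead R299 (bus 2026-08-23T22:22:12Z) on the lead's V22 BOOKING line, quoted verbatim:
«2026-08-23T23:50:48Z lead (g8) → ★ V22 BOOKING (R294/R299/R301; lead g8) → p2 (g12) [inject verbatim via mkcandidates.sh], referee (g30), p3 (g7),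
writer (g12), rb-theory (g16) cc owners: `StatementConjunctsV22.lean` = block A dff4d65aabaff373 (372 l) (T55a–d·T55 rb-p2 FreeEnergyLaw; T56a–e·T56
ds-1 Pressure-A; T57a,b·T57 ds-3 part D) · `…V22B.lean` = block B 609b24d462b1cfbc (382 l) (T58a,b·T58; T59a,b·T59; T46a–c·T46; T60a,b·T60) ·
`…V22C.lean` = block C e081844ac208ac1b (342 l) (T62a–e·T62 ds-3 part B; T63 ds-3 part H; T65a,b·T65 ds-4 CentreTube) · `…V22D.lean` = block D
a5d811943bcc1fdb (155 l; T61a–d·T61 ds-1 Pressure-B) «4 of 4»; numbered base A 6af97ec141cbb745 / B e6e71cdd58a392a0 / C bdd095e9b6ac86ce / D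
701ed23113043693 (numbered monolith 61108ff1cf2b97b8; byte-compare 35/35); map v1 127e243484fe3a02 + addenda 2254c71f1c2725b3; FINAL SET = p2 l.4946
(re-probe 23:44–23:47Z: T65/T61 GREEN, T64 rc 75). Every conjunct restates BY NAME a theorem already ACCEPTED in the tree (statement-index
bookkeeping; finite lattice, strong/intermediate coupling; nothing continuum / OS / infinite-volume-limit-as-physics / mass gap / Clay). Filer p2 g12
per R299 (p3 g7 does NOT claim; fallback only if no p2 INTENT/SUBMITTED by 00:30Z): `--kind definition`, ≤ 400 l/block, dry-runs, 00:10Z INTENT check,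
file A → B → C → D, ONE «SUBMITTED» line with pids + filed sha16s + consolidating decl names per block; referee g30 legs on FILED bytes; lead books on
ACCEPT + commit. V23 = T64a–e·T64 (rb-p1, unbuilt parent at the re-probe; numbered-PENDING 9e47a244954cc2f4), T65c (ds-4), T66a–e (ds-3), T67a–d +
T68a (rb-p2 098236ae25992b7a); no T68b. RECORD: v1.11 `YMGapStatementV1_11` p368908 7bed0099cf4c OF RECORD (l.4883); v1.12 := v1.11 ∧ V22 ∧ V22B ∧
V22C ∧ V22D by a later seat after V22* are built (p3 l.4789 (3), tools-p3/mkindex_next.py).».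
Fourth of four V22 block files (block 1 = `StatementConjunctsV22.lean (T55, T56, T57)`; block 2 = `StatementConjunctsV22B.lean (T58, T59, T46, T60)`; block 3 = `StatementConjunctsV22C.lean (T62, T63, T65)`).  These owner sets turned GREEN
at the pre-stage refreshes of 2026-08-23 23:10–23:55Z (their parents' farm oleans built during the evening backlog drain).  Texts, VERBATIM from the owner files:
T61 (β = 0 Balian–Drouffe–Itzykson coefficients, plaquette monotonicity, the two-sided pressure window |β_W| < 9/25; ds-1 g9 block B `HOME/ds/ds1g9/lean/V1X-CONJUNCTS-ds1g9-B.lean` 8da9823e7a47b120).  Only decl names change (map of record `HOME/p2/v22-prestage/RENAMES-PROPOSAL.txt` 127e243484fe3a02, lead R294/R301); the consolidating conjunctions are the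
pre-stage defaults (one per owner file; single-text sets have none); built mechanically by `HOME/p2/v22-prestage/mkmono.py`; byte-compare `bytecmp.py --map` = verbatim-modulo-map.

HONEST FRAMING. WHAT THIS IS: bodies `Tk_… : Prop` + witnesses `Tk_…_holds`, kernel-checked with NO hypothesis, closing by TREE constants only. STRONG-COUPLING LATTICE
statements about `SU(2)` / `SU(N)` lattice Yang–Mills with the Wilson action and the typed perturbation balls (one-state rates and symmetries, thermodynamic identities at and
near β = 0, screening / truncation / centre-tube statements on the balls, as listed).  Every window, radius or rate is where a BOUND closes, not a transition.  WHAT THIS IS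
NOT: no sharp constants, nothing about the crossover, scaling, a continuum limit, confinement in the continuum, or the Yang–Mills Millennium problem.
-/

noncomputable section

namespace Summit.Ventures.YMGap

/-! ### OWNER FILE `ds/ds1g9/lean/V1X-CONJUNCTS-ds1g9-B.lean` (sha16 8da9823e7a47b120) — section `V22_ds1_PressureB` -/
section V22_ds1_PressureB

/-!
# v1.x conjunct CANDIDATE texts for p3 (ds-1 g9, row type C-PRESS) — BLOCK B (parents: PressureZeroCoupling, PlaquetteMonotone,
# PressureTwoSided, PressureTwoSidedC2 — at the gate / staged) — NOT a proposal. Numbering is p3's.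
HONEST FRAMING: lattice strong-coupling statements; exact endpoint values at `β = 0`; monotone non-decreasing (not strict); `C²` two-sided
(not analyticity); nothing about the continuum or Clay.
-/


open MeasureTheory ProbabilityTheory Set
open scoped NNReal ContDiff
open Literature.MathematicalPhysics.QuantumLattice
open Literature.MathematicalPhysics.QuantumFieldTheory hiding ZdEdge Site


open Summit.Ventures.YMGap.PressureRegularity

/-- C-PRESS at `β = 0` (`SU(2)`, `d = 4`): THE DLR state at `β = 0` is the infinite Haar product; its plaquette covariances are
`δ_{pq}/4`; along ANY DLR selection on `[0, 9/25]` (Wilson `β_W`) the mean plaquette has right derivative `u'(0⁺) = 1/4` at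
`β_W = 0` (Balian–Drouffe–Itzykson leading coefficient) and the Wilson-normalised energy slope has right derivative `3/2`
(`g(β_W) = f(β_W/2) = -6β_W + (3/4)β_W² + o(β_W²)`); `f'(0⁺) = -12` in the tree coupling. -/
def T61a_SU2ZeroCouplingBDI : Prop :=
  (∀ ν : Measure (LGConfig 4 (Matrix.specialUnitaryGroup (Fin 2) ℂ)),
    ν ∈ ymGibbsMeasures (d := 4) (fundamentalRep (Fin 2)) 0 →
      ν = zdHaar 4 (Matrix.specialUnitaryGroup (Fin 2) ℂ) ∧
      ∀ p q : ZdPlaquette 4, cov[zdPlaquetteObs (fundamentalRep (Fin 2)) p.1 p.2.1.1 p.2.1.2,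
        zdPlaquetteObs (fundamentalRep (Fin 2)) q.1 q.2.1.1 q.2.1.2; ν] = if p = q then (1 / 4 : ℝ) else 0) ∧
  (∀ μ : ℝ → Measure (LGConfig 4 (Matrix.specialUnitaryGroup (Fin 2) ℂ)),
    (∀ βW ∈ Icc (0 : ℝ) (9 / 25), μ βW ∈ ymGibbsMeasures (d := 4) (fundamentalRep (Fin 2)) (2 * (βW / 4))) →
    (∀ p : ZdPlaquette 4,
      HasDerivWithinAt (fun t => ∫ U, zdPlaquetteObs (fundamentalRep (Fin 2)) p.1 p.2.1.1 p.2.1.2 U ∂(μ t))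
        (1 / 4 : ℝ) (Icc (0 : ℝ) (9 / 25)) 0) ∧
    HasDerivWithinAt (fun t => -∑ q : {q : Fin 4 × Fin 4 // q.1 < q.2}, ((1 : ℝ) -
        ∫ U, zdPlaquetteObs (fundamentalRep (Fin 2)) 0 q.1.1 q.1.2 U ∂(μ t))) (3 / 2 : ℝ) (Icc (0 : ℝ) (9 / 25)) 0) ∧
  HasDerivWithinAt (freeEnergyDensity 4 (fundamentalRep (Fin 2))) (-12 : ℝ) (Icc (0 : ℝ) (9 / 50)) 0

/-- Proof of `T61a_SU2ZeroCouplingBDI`. -/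
theorem T61a_SU2ZeroCouplingBDI_holds : T61a_SU2ZeroCouplingBDI :=
  ⟨fun _ hν => ⟨su2_eq_zdHaar_of_mem_zero hν, fun p q => su2_cov_plaquette_zero hν p q⟩,
    fun _ hμ => ⟨fun p => su2_hasDerivWithinAt_plaquette_zero hμ p, su2_hasDerivWithinAt_energyWilson_zero hμ⟩,
    su2_hasDerivWithinAt_freeEnergyDensity_zero⟩

/-- C-PRESS / monotone plaquette (`SU(2)`, `d = 4`): along ANY DLR selection on `[0, 9/25]` (Wilson `β_W`) the mean plaquette
`u(β_W) = ⟨½ Re tr U_p⟩` is NON-DECREASING on `[0, 9/25]` for every plaquette `p`; `f'(β) = -12(1 - u)` at every `0 < β < 9/50`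
(tree coupling) for every DLR state; and the plaquette–plaquette static susceptibility `Σ_q Cov_ν(W_p, W_q)` is `≥ 0` there.
No correlation inequality is used. -/
def T61b_SU2PlaquetteMonotone : Prop :=
  (∀ μ : ℝ → Measure (LGConfig 4 (Matrix.specialUnitaryGroup (Fin 2) ℂ)),
    (∀ βW ∈ Icc (0 : ℝ) (9 / 25), μ βW ∈ ymGibbsMeasures (d := 4) (fundamentalRep (Fin 2)) (2 * (βW / 4))) →
    ∀ p : ZdPlaquette 4,
      MonotoneOn (fun βW => ∫ U, zdPlaquetteObs (fundamentalRep (Fin 2)) p.1 p.2.1.1 p.2.1.2 U ∂(μ βW))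
        (Icc (0 : ℝ) (9 / 25))) ∧
  (∀ β ∈ Ioo (0 : ℝ) (9 / 50), ∀ ν : Measure (LGConfig 4 (Matrix.specialUnitaryGroup (Fin 2) ℂ)),
    ν ∈ ymGibbsMeasures (d := 4) (fundamentalRep (Fin 2)) β →
      deriv (freeEnergyDensity 4 (fundamentalRep (Fin 2))) β =
        -12 * (1 - ∫ U, zdPlaquetteObs (fundamentalRep (Fin 2)) 0 0 1 U ∂ν) ∧
      ∀ p : ZdPlaquette 4, 0 ≤ ∑' q : ZdPlaquette 4,
        cov[zdPlaquetteObs (fundamentalRep (Fin 2)) p.1 p.2.1.1 p.2.1.2,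
          zdPlaquetteObs (fundamentalRep (Fin 2)) q.1 q.2.1.1 q.2.1.2; ν])

/-- Proof of `T61b_SU2PlaquetteMonotone`. -/
theorem T61b_SU2PlaquetteMonotone_holds : T61b_SU2PlaquetteMonotone :=
  ⟨fun _ hμ p => su2_meanPlaquette_monotoneOn hμ p,
    fun _ hβ _ hν => ⟨su2_deriv_freeEnergyDensity_eq_plaquette hβ hν, fun p => su2_plaquette_responseSum_nonneg hβ hν p⟩⟩

/-- C-PRESS / monotone plaquette (every `SU(N)`, `N ≥ 2`, every `d ≥ 2`): on `[0, N/(12(d-1))]` the mean plaquette is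
non-decreasing along any DLR selection, and the plaquette–plaquette susceptibility is `≥ 0` on the open window. -/
def T61c_SUNDimPlaquetteMonotone : Prop :=
  ∀ d N : ℕ, 2 ≤ d → 2 ≤ N →
    (∀ μ : ℝ → Measure (LGConfig d (Matrix.specialUnitaryGroup (Fin N) ℂ)),
      (∀ b ∈ Icc (0 : ℝ) ((N : ℝ) / (12 * ((d : ℝ) - 1))), μ b ∈ ymGibbsMeasures (d := d) (fundamentalRep (Fin N)) b) →
      ∀ p : ZdPlaquette d,
        MonotoneOn (fun b => ∫ U, zdPlaquetteObs (fundamentalRep (Fin N)) p.1 p.2.1.1 p.2.1.2 U ∂(μ b))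
          (Icc (0 : ℝ) ((N : ℝ) / (12 * ((d : ℝ) - 1))))) ∧
    (∀ b ∈ Ioo (0 : ℝ) ((N : ℝ) / (12 * ((d : ℝ) - 1))), ∀ ν : Measure (LGConfig d (Matrix.specialUnitaryGroup (Fin N) ℂ)),
      ν ∈ ymGibbsMeasures (d := d) (fundamentalRep (Fin N)) b → ∀ p : ZdPlaquette d,
        0 ≤ ∑' q : ZdPlaquette d, cov[zdPlaquetteObs (fundamentalRep (Fin N)) p.1 p.2.1.1 p.2.1.2,
          zdPlaquetteObs (fundamentalRep (Fin N)) q.1 q.2.1.1 q.2.1.2; ν])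

/-- Proof of `T61c_SUNDimPlaquetteMonotone`. -/
theorem T61c_SUNDimPlaquetteMonotone_holds : T61c_SUNDimPlaquetteMonotone :=
  fun _ _ hd hN => ⟨fun _ hμ p => plaquette_monotoneOn_dim_thooft hd hN hμ p,
    fun _ hb _ hν p => plaquette_responseSum_nonneg_dim_thooft hd hN hb hν p⟩

/-- C-PRESS two-sided (`SU(2)`, `d = 4`): on the TWO-SIDED window `|β| < 9/50` (tree; `|β_W| < 9/25`) the free energy density is
`C²` (`ContDiffOn ℝ 2`), differentiable AT `β = 0` with `f'(0) = -12` and `(f')'(0) = 6`; the DLR state is unique at every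
`|β| ≤ 9/50` and the mean plaquette is odd in `β`. -/
def T61d_SU2PressureTwoSided : Prop :=
  ContDiffOn ℝ 2 (freeEnergyDensity 4 (fundamentalRep (Fin 2))) (Ioo (-(9 / 50) : ℝ) (9 / 50)) ∧
  HasDerivAt (freeEnergyDensity 4 (fundamentalRep (Fin 2))) (-12 : ℝ) 0 ∧
  HasDerivAt (deriv (freeEnergyDensity 4 (fundamentalRep (Fin 2)))) (6 : ℝ) 0 ∧
  (∀ β : ℝ, |β| ≤ 9 / 50 → (ymGibbsMeasures (d := 4) (fundamentalRep (Fin 2)) β).Subsingleton) ∧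
  (∀ β : ℝ, |β| ≤ 9 / 50 → ∀ ν ν' : Measure (LGConfig 4 (Matrix.specialUnitaryGroup (Fin 2) ℂ)),
    ν ∈ ymGibbsMeasures (d := 4) (fundamentalRep (Fin 2)) (-β) → ν' ∈ ymGibbsMeasures (d := 4) (fundamentalRep (Fin 2)) β →
    ∀ p : ZdPlaquette 4, ∫ U, plaquetteObs (fundamentalRep (Fin 2)) p.1 p.2.1.1 p.2.1.2 U ∂ν =
      -∫ U, plaquetteObs (fundamentalRep (Fin 2)) p.1 p.2.1.1 p.2.1.2 U ∂ν')

/-- Proof of `T61d_SU2PressureTwoSided`. -/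
theorem T61d_SU2PressureTwoSided_holds : T61d_SU2PressureTwoSided :=
  ⟨su2_contDiffOn_two_freeEnergyDensity_abs, su2_hasDerivAt_freeEnergyDensity_zero,
    su2_hasDerivAt_deriv_freeEnergyDensity_zero, fun _ hβ => su2_subsingleton_ymGibbsMeasures_abs hβ,
    fun _ hβ _ _ hν hν' p => su2_integral_plaquetteObs_neg hβ hν hν' p⟩

/-- Block B holds. -/
theorem v1x_ds1g9_blockB_holds :
    T61a_SU2ZeroCouplingBDI ∧ T61b_SU2PlaquetteMonotone ∧ T61c_SUNDimPlaquetteMonotone ∧ T61d_SU2PressureTwoSided :=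
  ⟨T61a_SU2ZeroCouplingBDI_holds, T61b_SU2PlaquetteMonotone_holds, T61c_SUNDimPlaquetteMonotone_holds, T61d_SU2PressureTwoSided_holds⟩



end V22_ds1_PressureB

/-! ### DEFAULT GROUPING (p2): one consolidating conjunction per owner file — `G_<tag> := T_a ∧ T_b ∧ …` + `_holds`.
The lead composes V22 by theme; p3 renames `G_<tag> ↦ T<k>_<Name>` (via --map) or regroups at will; these are additions, not owner bytes. -/
section V22_groups_D

/-- Default group for section `V22_ds1_PressureB`: the conjunction of its 4 owner texts. -/
def T61_ZeroCouplingMonotoneTwoSided : Prop :=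
  T61a_SU2ZeroCouplingBDI ∧ T61b_SU2PlaquetteMonotone ∧ T61c_SUNDimPlaquetteMonotone ∧ T61d_SU2PressureTwoSided

/-- `T61_ZeroCouplingMonotoneTwoSided` holds (componentwise by the owners' `_holds`). -/
theorem T61_ZeroCouplingMonotoneTwoSided_holds : T61_ZeroCouplingMonotoneTwoSided :=
  ⟨T61a_SU2ZeroCouplingBDI_holds, T61b_SU2PlaquetteMonotone_holds, T61c_SUNDimPlaquetteMonotone_holds, T61d_SU2PressureTwoSided_holds⟩

end V22_groups_D

end Summit.Ventures.YMGap

end
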